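import Summits.CriticalPhenomena.PercolationContinuityZ3.Theses.PercNearOneGluing
import Summits.CriticalPhenomena.PercolationContinuityZ3.Theorems.PercNearOneGluingHalfWeightReduction
import Summits.CriticalPhenomena.PercolationContinuityZ3.Theorems.PercNearOneGluingNoHeavyLowerTailResidualOfNearOneGluing
import Summits.CriticalPhenomena.PercolationContinuityZ3.Theorems.PercNearOneGluingNoHeavyLowerTailReduction
import Summits.CriticalPhenomena.PercolationContinuityZ3.Theorems.AdditiveGluing.Negative.CertSoundness
import Literature.Probability.Percolation.PercolationProofs

/-!
# Crux `PercNearOneGluing.NoHeavyLowerTail` (stmt-CriticalPhenomena-4575): the p = 1/2 glue of the typed skeleton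
# `nhlt_typed_skeleton` — additive gluing at density 1/2 (AGH) and its exchange form (EXH) imply the crux

Typing / skeleton seat `planner-rtask-CriticalPhenomena-PercNearOneG-57e7190a-0`, 2026-08-17; lands with
`--supports stmt-CriticalPhenomena-4575` (registered sub-goals `nearOneGluing_of_additiveGluingHalf`,
`additiveGluingHalf_of_exchangeHalf`, `noHeavyLowerTail_of_additiveGluingHalf`, `noHeavyLowerTail_of_exchangeHalf`,
`additiveGluingHalf_of_additiveGluing`).  Pure logic / one measure split over LANDED theorems; nothing here asserts
AGH or EXH — both are HYPOTHESES (stubs S2, S3 of the skeleton; strategist s1's STRATEGY-CENSUS.md forms, 0 failures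
on every simple graph with n ≤ 6 at p = 1/2).

* `AGH` (additive gluing at 1/2): for every simple graph `G` on `Fin n`, `A, o, b`, `t ≥ 0` with `P(a ↔ b) ≥ 1 − t` on `A`:
  `P_{G,1/2}(o ↔ A) − t ≤ P_{G,1/2}(o ↔ b)` — the sibling crux `AdditiveGluing` (stmt-4576) at uniform weight 1/2
  (`additiveGluingHalf_of_additiveGluing`, via `bondPercolation_eq_prodBernoulli_wHalf`).
* `nearOneGluing_of_additiveGluingHalf` — AGH ⇒ `NearOneGluing`: with `t = δ = ε/2` AGH is the hypothesis of the closed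
  support item `HalfWeightReduction` (`halfWeightReduction_proof`, Kozma–Nitzan arXiv:2401.12397 §5.6 (1)).
* `additiveGluingHalf_of_exchangeHalf` — EXH ⇒ AGH, where EXH says: if `a⋆ ∈ A` minimises `P(a ↔ b)` over `A` then
  `P(a⋆ ↔ b, o ↔ A, o ↮ b) ≤ P(a⋆ ↮ b, o ↔ b)`.  Proof: split `{o ↔ A} ∩ {o ↮ b}` along `{a⋆ ↔ b}`; the first part is
  bounded by EXH, the second by `{a⋆ ↮ b} ∖ {o ↔ b}`; the two bounds add up to `P(a⋆ ↮ b) = 1 − P(a⋆ ↔ b) ≤ t`.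
* `noHeavyLowerTail_of_additiveGluingHalf`, `noHeavyLowerTail_of_exchangeHalf` — composed with the landed
  `manyFingersLargePocket_of_nearOneGluing` (p81702) and `noHeavyLowerTail_of_manyFingersLargePocket` (p76496): each of
  AGH, EXH implies the crux BY NAME.
-/

noncomputable section

namespace Summit.CriticalPhenomena.PercolationContinuityZ3.Theorems

open scoped Classical BigOperators
open MeasureTheory Set
open Literature.Probability.LatticeModels (prodBernoulli)
open Literature.Probability.Percolation (openConn openConnIn BondConfig bondPercolation half
  measurableSet_openConn_holds)
open Summit.CriticalPhenomena.PercolationContinuityZ3.Theorems.AdditiveGluing.Negative.Cert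
  (wHalf Eset edgeList bondPercolation_eq_prodBernoulli_wHalf)

/-- **`AdditiveGluing` at uniform weight 1/2 is AGH**: specialise the sibling crux (stmt-4576) to the weights
`wHalf (Eset (edgeList G))` (`bondPercolation_eq_prodBernoulli_wHalf`). -/
theorem additiveGluingHalf_of_additiveGluing :
    Summit.CriticalPhenomena.PercolationContinuityZ3.Theses.PercNearOneGluing.AdditiveGluing →
      ∀ (n : ℕ) (G : SimpleGraph (Fin n)) (A : Finset (Fin n)) (o b : Fin n) (t : ℝ), 0 ≤ t → (∀ a ∈ A, 1 - t ≤ (Literature.Probability.Percolation.bondPercolation G Literature.Probability.Percolation.half).real (Literature.Probability.Percolation.openConn a b)) → (Literature.Probability.Percolation.bondPercolation G Literature.Probability.Percolation.half).real (⋃ a ∈ A, Literature.Probability.Percolation.openConn o a) - t ≤ (Literature.Probability.Percolation.bondPercolation G Literature.Probability.Percolation.half).real (Literature.Probability.Percolation.openConn o b) := by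
  intro hAG n G A o b t ht hrel
  rw [bondPercolation_eq_prodBernoulli_wHalf G] at hrel ⊢
  exact hAG n _ A o b t ht hrel

/-- **AGH ⇒ `NearOneGluing`** (δ = ε/2 makes AGH the hypothesis of `HalfWeightReduction`; `halfWeightReduction_proof`). -/
theorem nearOneGluing_of_additiveGluingHalf :
    (∀ (n : ℕ) (G : SimpleGraph (Fin n)) (A : Finset (Fin n)) (o b : Fin n) (t : ℝ), 0 ≤ t → (∀ a ∈ A, 1 - t ≤ (Literature.Probability.Percolation.bondPercolation G Literature.Probability.Percolation.half).real (Literature.Probability.Percolation.openConn a b)) → (Literature.Probability.Percolation.bondPercolation G Literature.Probability.Percolation.half).real (⋃ a ∈ A, Literature.Probability.Percolation.openConn o a) - t ≤ (Literature.Probability.Percolation.bondPercolation G Literature.Probability.Percolation.half).real (Literature.Probability.Percolation.openConn o b)) →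
      Summit.CriticalPhenomena.PercolationContinuityZ3.Theses.PercNearOneGluing.NearOneGluing := by
  intro hA
  refine halfWeightReduction_proof ?_
  intro ε hε
  refine ⟨ε / 2, half_pos hε, ?_⟩
  intro n G A o b hoA hAb
  have h := hA n G A o b (ε / 2) (half_pos hε).le (fun a ha => (hAb a ha).le)
  linarith

/-- **EXH ⇒ AGH**: split `{o ↔ A} ∩ {o ↮ b}` along `{a⋆ ↔ b}` for a marginal minimiser `a⋆` (`Finset.exists_min_image`);
EXH bounds the first part by `P(a⋆ ↮ b, o ↔ b)`, monotonicity the second by `P({a⋆ ↮ b} ∖ {o ↔ b})`, and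
`measureReal_inter_add_sdiff` + `probReal_compl_eq_one_sub` turn the sum into `1 − P(a⋆ ↔ b) ≤ t`. -/
theorem additiveGluingHalf_of_exchangeHalf :
    (∀ (n : ℕ) (G : SimpleGraph (Fin n)) (A : Finset (Fin n)) (o b aStar : Fin n), aStar ∈ A → (∀ a ∈ A, (Literature.Probability.Percolation.bondPercolation G Literature.Probability.Percolation.half).real (Literature.Probability.Percolation.openConn aStar b) ≤ (Literature.Probability.Percolation.bondPercolation G Literature.Probability.Percolation.half).real (Literature.Probability.Percolation.openConn a b)) → (Literature.Probability.Percolation.bondPercolation G Literature.Probability.Percolation.half).real (Literature.Probability.Percolation.openConn aStar b ∩ ((⋃ a ∈ A, Literature.Probability.Percolation.openConn o a) ∩ (Literature.Probability.Percolation.openConn o b)ᶜ)) ≤ (Literature.Probability.Percolation.bondPercolation G Literature.Probability.Percolation.half).real ((Literature.Probability.Percolation.openConn aStar b)ᶜ ∩ Literature.Probability.Percolation.openConn o b)) →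
      ∀ (n : ℕ) (G : SimpleGraph (Fin n)) (A : Finset (Fin n)) (o b : Fin n) (t : ℝ), 0 ≤ t → (∀ a ∈ A, 1 - t ≤ (Literature.Probability.Percolation.bondPercolation G Literature.Probability.Percolation.half).real (Literature.Probability.Percolation.openConn a b)) → (Literature.Probability.Percolation.bondPercolation G Literature.Probability.Percolation.half).real (⋃ a ∈ A, Literature.Probability.Percolation.openConn o a) - t ≤ (Literature.Probability.Percolation.bondPercolation G Literature.Probability.Percolation.half).real (Literature.Probability.Percolation.openConn o b) := by
  intro hX n G A o b t ht hrel
  by_cases hA : A = ∅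
  · subst hA
    simp only [Finset.notMem_empty, Set.iUnion_of_empty, Set.iUnion_empty, measureReal_empty]
    linarith [measureReal_nonneg (μ := bondPercolation G half) (s := openConn o b)]
  obtain ⟨aS, haS, hmin⟩ :=
    A.exists_min_image (fun a => (bondPercolation G half).real (openConn a b)) (Finset.nonempty_iff_ne_empty.2 hA)
  have hx : (bondPercolation G half).real
      (openConn aS b ∩ ((⋃ a ∈ A, openConn o a) ∩ (openConn o b)ᶜ)) ≤
      (bondPercolation G half).real ((openConn aS b)ᶜ ∩ openConn o b) :=
    hX n G A o b aS haS (fun a ha => hmin a ha)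
  have h1 : (bondPercolation G half).real (⋃ a ∈ A, openConn o a) ≤
      (bondPercolation G half).real ((⋃ a ∈ A, openConn o a) ∩ (openConn o b)ᶜ) +
        (bondPercolation G half).real (openConn o b) :=
    (measureReal_mono (fun ω hω => by
      by_cases hb : ω ∈ openConn o b
      · exact Or.inr hb
      · exact Or.inl ⟨hω, hb⟩)).trans (measureReal_union_le _ _)
  have h2 : (bondPercolation G half).real ((⋃ a ∈ A, openConn o a) ∩ (openConn o b)ᶜ) ≤
      (bondPercolation G half).real (openConn aS b ∩ ((⋃ a ∈ A, openConn o a) ∩ (openConn o b)ᶜ)) +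
        (bondPercolation G half).real ((openConn aS b)ᶜ ∩ ((⋃ a ∈ A, openConn o a) ∩ (openConn o b)ᶜ)) :=
    (measureReal_mono (fun ω hω => by
      by_cases he : ω ∈ openConn aS b
      · exact Or.inl ⟨he, hω⟩
      · exact Or.inr ⟨he, hω⟩)).trans (measureReal_union_le _ _)
  have h3 : (bondPercolation G half).real ((openConn aS b)ᶜ ∩ ((⋃ a ∈ A, openConn o a) ∩ (openConn o b)ᶜ)) ≤
      (bondPercolation G half).real ((openConn aS b)ᶜ \ openConn o b) :=
    measureReal_mono fun ω hω => ⟨hω.1, hω.2.2⟩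
  have h4 : (bondPercolation G half).real ((openConn aS b)ᶜ ∩ openConn o b) +
      (bondPercolation G half).real ((openConn aS b)ᶜ \ openConn o b) =
      (bondPercolation G half).real (openConn aS b)ᶜ :=
    measureReal_inter_add_sdiff (measurableSet_openConn_holds o b)
  have h5 : (bondPercolation G half).real (openConn aS b)ᶜ = 1 - (bondPercolation G half).real (openConn aS b) :=
    probReal_compl_eq_one_sub (measurableSet_openConn_holds aS b)
  have h6 := hrel aS haS
  linarith

/-- **AGH ⇒ the crux `NoHeavyLowerTail`** (by name), through `NearOneGluing` and the landed residual reductions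
`manyFingersLargePocket_of_nearOneGluing` (p81702), `noHeavyLowerTail_of_manyFingersLargePocket` (p76496). -/
theorem noHeavyLowerTail_of_additiveGluingHalf :
    (∀ (n : ℕ) (G : SimpleGraph (Fin n)) (A : Finset (Fin n)) (o b : Fin n) (t : ℝ), 0 ≤ t → (∀ a ∈ A, 1 - t ≤ (Literature.Probability.Percolation.bondPercolation G Literature.Probability.Percolation.half).real (Literature.Probability.Percolation.openConn a b)) → (Literature.Probability.Percolation.bondPercolation G Literature.Probability.Percolation.half).real (⋃ a ∈ A, Literature.Probability.Percolation.openConn o a) - t ≤ (Literature.Probability.Percolation.bondPercolation G Literature.Probability.Percolation.half).real (Literature.Probability.Percolation.openConn o b)) →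
      Summit.CriticalPhenomena.PercolationContinuityZ3.Theses.PercNearOneGluing.NoHeavyLowerTail :=
  fun hA => noHeavyLowerTail_of_manyFingersLargePocket
    (manyFingersLargePocket_of_nearOneGluing (nearOneGluing_of_additiveGluingHalf hA))

/-- **EXH ⇒ the crux `NoHeavyLowerTail`** (by name): `additiveGluingHalf_of_exchangeHalf` then
`noHeavyLowerTail_of_additiveGluingHalf`. -/
theorem noHeavyLowerTail_of_exchangeHalf :
    (∀ (n : ℕ) (G : SimpleGraph (Fin n)) (A : Finset (Fin n)) (o b aStar : Fin n), aStar ∈ A → (∀ a ∈ A, (Literature.Probability.Percolation.bondPercolation G Literature.Probability.Percolation.half).real (Literature.Probability.Percolation.openConn aStar b) ≤ (Literature.Probability.Percolation.bondPercolation G Literature.Probability.Percolation.half).real (Literature.Probability.Percolation.openConn a b)) → (Literature.Probability.Percolation.bondPercolation G Literature.Probability.Percolation.half).real (Literature.Probability.Percolation.openConn aStar b ∩ ((⋃ a ∈ A, Literature.Probability.Percolation.openConn o a) ∩ (Literature.Probability.Percolation.openConn o b)ᶜ)) ≤ (Literature.Probability.Percolation.bondPercolation G Literature.Probability.Percolation.half).real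 ((Literature.Probability.Percolation.openConn aStar b)ᶜ ∩ Literature.Probability.Percolation.openConn o b)) →
      Summit.CriticalPhenomena.PercolationContinuityZ3.Theses.PercNearOneGluing.NoHeavyLowerTail :=
  fun hX => noHeavyLowerTail_of_additiveGluingHalf (additiveGluingHalf_of_exchangeHalf hX)

end Summit.CriticalPhenomena.PercolationContinuityZ3.Theorems

end
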